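import Summits.CriticalPhenomena.PercolationContinuityZ3.Theorems.PercNearOneGluingNoHeavyLowerTailQ7PsiFourWorlds
import HarnessLib

/-!
# `NoHeavyLowerTail` (stmt-CriticalPhenomena-4575) — (GΨ₄) for four relays from its three observer halves

Support file (`--supports stmt-CriticalPhenomena-4575`), coupling seat `prim-cplus-coupling` (gen 9).  No definitions, no named
facts, no sorries.

Setting (seat memo prim-cplus-coupling/Q7-FOUR-RELAYS.md §1): observer `o`, strong relays `x, y, u`, weak relay `z`, monotone real
cluster property `F`.  A split credits the observer world "`C_o ∩ {x,y,u} = S`, `o ↮ z`" to the relays in `S` with shares summing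
to one; the `x`-half (P_x*) says that for EVERY monotone `G`
`λ_x ∫_{x↮z} G(C x) ≤ ∫_{A_x} G(C x) + t_{xy,x} ∫_{B_xy} G(C x) + t_{xu,x} ∫_{B_xu} G(C x) + s_x ∫_{T_x} G(C x)`.

* `Q7Psi.gpsi_four_robust_of_halves` — the three halves (all monotone `G`), a split, and `0 ≤ λ_i ≤ 1` give the hypothesis-free
  form `Σ_i min(E F(C i) − E F(C z), 0) ≤ ∫_J F(C o) − ∫_J F(C z)`, `J = o↔x ∪ o↔y ∪ o↔u` (observer part: the seven worlds,
  `Q7Psi.integral_sevenWorlds`; weak-relay part: `Q7Psi.zquarter_of_oquarter` three times);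
* `Q7Psi.gpsi_four_of_halves` — hence (GΨ₄): `E F(C z) ≤ E F(C i)` (`i = x,y,u`) ⟹ `∫_J F(C z) ≤ ∫_J F(C o)`.
The halves themselves are reduced in the memo (§3–§4) to vdBHK 1.3, COV(τ) with avoided sets (`CovTau.markerDominanceAvoid`) and
prim-hp-8's conditioned slack hierarchy at the cell (1,1), with an explicit positive split — the next file of this chain.
[cite: KozmaNitzan2024, §5.1 (pp. 31–32), Question 7 (p. 36), Conjecture 4 (p. 32)] [cite: VandenbergHaggstromKahn2005, §2.1 Lemma 2.4 (p. 10)]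
-/

namespace Summit.CriticalPhenomena.PercolationContinuityZ3.Theorems

open MeasureTheory Set Literature.Probability.LatticeModels Literature.Probability.Percolation
open scoped Classical
open KNPreFKG BHK2006

noncomputable section

namespace Q7Psi

variable {V : Type*} [Fintype V]

/-- **The four-relay certificate, hypothesis-free form, from the three observer halves.**  With `J = o↔x ∪ o↔y ∪ o↔u`,
`D_i = ∫ F(C i) − ∫ F(C z)`: if the `x`-, `y`- and `u`-halves hold for every monotone `G` with multipliers `0 ≤ λ_i ≤ 1` and a split
(`t_{xy,x} + t_{xy,y} = 1`, `t_{xu,x} + t_{xu,u} = 1`, `t_{yu,y} + t_{yu,u} = 1`, `s_x + s_y + s_u = 1`), then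
`min(D_x,0) + min(D_y,0) + min(D_u,0) ≤ ∫_J F(C o) − ∫_J F(C z)`.
[cite: KozmaNitzan2024, §5.1 (pp. 31–32), Conjecture 4 (p. 32)] [cite: VandenbergHaggstromKahn2005, §2.1 Lemma 2.4 (p. 10)] -/
theorem gpsi_four_robust_of_halves (w : Sym2 V → unitInterval) (o x y u z : V) (F : Set V → ℝ)
    (hF : ∀ S T : Set V, S ⊆ T → F S ≤ F T)
    (txy tyx txu tux tyu tuy sx sy su lx ly lu : ℝ)
    (hxy : txy + tyx = 1) (hxu : txu + tux = 1) (hyu : tyu + tuy = 1) (hs : sx + sy + su = 1)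
    (hlx : 0 ≤ lx) (hlx1 : lx ≤ 1) (hly : 0 ≤ ly) (hly1 : ly ≤ 1) (hlu : 0 ≤ lu) (hlu1 : lu ≤ 1)
    (hPx : (∀ G : Set V → ℝ, (∀ S T : Set V, S ⊆ T → G S ≤ G T) →
      lx * ∫ ω in {ω : BondConfig V | ¬ (openGraph ω).Reachable x z}, G (openCluster ω x) ∂(prodBernoulli w) ≤
        (∫ ω in (openConn x o ∩ {ω | ¬ (openGraph ω).Reachable x y} ∩ {ω | ¬ (openGraph ω).Reachable x u} ∩ {ω | ¬ (openGraph ω).Reachable x z}), G (openCluster ω x) ∂(prodBernoulli w)) +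
        txy * (∫ ω in (openConn x o ∩ openConn x y ∩ {ω | ¬ (openGraph ω).Reachable x u} ∩ {ω | ¬ (openGraph ω).Reachable x z}), G (openCluster ω x) ∂(prodBernoulli w)) +
        txu * (∫ ω in (openConn x o ∩ openConn x u ∩ {ω | ¬ (openGraph ω).Reachable x y} ∩ {ω | ¬ (openGraph ω).Reachable x z}), G (openCluster ω x) ∂(prodBernoulli w)) +
        sx * (∫ ω in (openConn x o ∩ openConn x y ∩ openConn x u ∩ {ω | ¬ (openGraph ω).Reachable x z}), G (openCluster ω x) ∂(prodBernoulli w))))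
    (hPy : (∀ G : Set V → ℝ, (∀ S T : Set V, S ⊆ T → G S ≤ G T) →
      ly * ∫ ω in {ω : BondConfig V | ¬ (openGraph ω).Reachable y z}, G (openCluster ω y) ∂(prodBernoulli w) ≤
        (∫ ω in (openConn y o ∩ {ω | ¬ (openGraph ω).Reachable y x} ∩ {ω | ¬ (openGraph ω).Reachable y u} ∩ {ω | ¬ (openGraph ω).Reachable y z}), G (openCluster ω y) ∂(prodBernoulli w)) +
        tyx * (∫ ω in (openConn y o ∩ openConn y x ∩ {ω | ¬ (openGraph ω).Reachable y u} ∩ {ω | ¬ (openGraph ω).Reachable y z}), G (openCluster ω y) ∂(prodBernoulli w)) +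
        tyu * (∫ ω in (openConn y o ∩ openConn y u ∩ {ω | ¬ (openGraph ω).Reachable y x} ∩ {ω | ¬ (openGraph ω).Reachable y z}), G (openCluster ω y) ∂(prodBernoulli w)) +
        sy * (∫ ω in (openConn y o ∩ openConn y x ∩ openConn y u ∩ {ω | ¬ (openGraph ω).Reachable y z}), G (openCluster ω y) ∂(prodBernoulli w))))
    (hPu : (∀ G : Set V → ℝ, (∀ S T : Set V, S ⊆ T → G S ≤ G T) →
      lu * ∫ ω in {ω : BondConfig V | ¬ (openGraph ω).Reachable u z}, G (openCluster ω u) ∂(prodBernoulli w) ≤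
        (∫ ω in (openConn u o ∩ {ω | ¬ (openGraph ω).Reachable u x} ∩ {ω | ¬ (openGraph ω).Reachable u y} ∩ {ω | ¬ (openGraph ω).Reachable u z}), G (openCluster ω u) ∂(prodBernoulli w)) +
        tux * (∫ ω in (openConn u o ∩ openConn u x ∩ {ω | ¬ (openGraph ω).Reachable u y} ∩ {ω | ¬ (openGraph ω).Reachable u z}), G (openCluster ω u) ∂(prodBernoulli w)) +
        tuy * (∫ ω in (openConn u o ∩ openConn u y ∩ {ω | ¬ (openGraph ω).Reachable u x} ∩ {ω | ¬ (openGraph ω).Reachable u z}), G (openCluster ω u) ∂(prodBernoulli w)) +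
        su * (∫ ω in (openConn u o ∩ openConn u x ∩ openConn u y ∩ {ω | ¬ (openGraph ω).Reachable u z}), G (openCluster ω u) ∂(prodBernoulli w)))) :
    min ((∫ ω, F (openCluster ω x) ∂(prodBernoulli w)) - ∫ ω, F (openCluster ω z) ∂(prodBernoulli w)) 0 +
      min ((∫ ω, F (openCluster ω y) ∂(prodBernoulli w)) - ∫ ω, F (openCluster ω z) ∂(prodBernoulli w)) 0 +
      min ((∫ ω, F (openCluster ω u) ∂(prodBernoulli w)) - ∫ ω, F (openCluster ω z) ∂(prodBernoulli w)) 0 ≤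
      (∫ ω in (openConn o x ∪ openConn o y ∪ openConn o u), F (openCluster ω o) ∂(prodBernoulli w)) -
        ∫ ω in (openConn o x ∪ openConn o y ∪ openConn o u), F (openCluster ω z) ∂(prodBernoulli w) := by
  classical
  have hmeas : ∀ S : Set (BondConfig V), MeasurableSet S := fun _ => MeasurableSet.of_discrete
  have hint : ∀ (g : BondConfig V → ℝ) (S : Set (BondConfig V)), IntegrableOn g S (prodBernoulli w) :=
    fun g S => (Integrable.of_finite).integrableOn
  -- weak-relay halves by duality, observer halves at `G = F`
  have hZx := zquarter_of_oquarter w o x y u z F hF txy txu sx lx hPx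
  have hZy := zquarter_of_oquarter w o y x u z F hF tyx tyu sy ly hPy
  have hZu := zquarter_of_oquarter w o u x y z F hF tux tuy su lu hPu
  have hOx := hPx F hF
  have hOy := hPy F hF
  have hOu := hPu F hF
  -- rewrite the `y`- and `u`-owner forms of the shared worlds into the `x`-/`y`-owner forms
  rw [integral_pairWorld_swap w o x y u z F, integral_tripleWorld_swap w o x y u z F] at hOy
  rw [integral_pairWorld_swap w o x u y z F, integral_pairWorld_swap w o y u x z F,
    integral_tripleWorld_swap_u w o x y u z F] at hOu
  rw [integral_pairWorld_swap' w o x y u z, integral_tripleWorld_swap' w o x y u z] at hZy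
  rw [integral_pairWorld_swap' w o x u y z, integral_pairWorld_swap' w o y u x z,
    integral_tripleWorld_swap_u' w o x y u z] at hZu
  -- the seven-world splits of `∫_J'`
  have sO := integral_sevenWorlds w o x y u z (fun ω => F (openCluster ω o))
  have sZ := integral_sevenWorlds w o x y u z (fun ω => F (openCluster ω z))
  -- on each world the observer's cluster is the owner's
  have cAx : ∫ ω in (openConn x o ∩ {ω | ¬ (openGraph ω).Reachable x y} ∩ {ω | ¬ (openGraph ω).Reachable x u} ∩ {ω | ¬ (openGraph ω).Reachable x z}), F (openCluster ω o) ∂(prodBernoulli w) = ∫ ω in (openConn x o ∩ {ω | ¬ (openGraph ω).Reachable x y} ∩ {ω | ¬ (openGraph ω).Reachable x u} ∩ {ω | ¬ (openGraph ω).Reachable x z}), F (openCluster ω x) ∂(prodBernoulli w) :=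
    setIntegral_congr_fun (hmeas _) fun ω hω => by
      rw [openCluster_eq_of_reachable (show (openGraph ω).Reachable x o from hω.1.1.1)]
  have cAy : ∫ ω in (openConn y o ∩ {ω | ¬ (openGraph ω).Reachable y x} ∩ {ω | ¬ (openGraph ω).Reachable y u} ∩ {ω | ¬ (openGraph ω).Reachable y z}), F (openCluster ω o) ∂(prodBernoulli w) = ∫ ω in (openConn y o ∩ {ω | ¬ (openGraph ω).Reachable y x} ∩ {ω | ¬ (openGraph ω).Reachable y u} ∩ {ω | ¬ (openGraph ω).Reachable y z}), F (openCluster ω y) ∂(prodBernoulli w) :=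
    setIntegral_congr_fun (hmeas _) fun ω hω => by
      rw [openCluster_eq_of_reachable (show (openGraph ω).Reachable y o from hω.1.1.1)]
  have cAu : ∫ ω in (openConn u o ∩ {ω | ¬ (openGraph ω).Reachable u x} ∩ {ω | ¬ (openGraph ω).Reachable u y} ∩ {ω | ¬ (openGraph ω).Reachable u z}), F (openCluster ω o) ∂(prodBernoulli w) = ∫ ω in (openConn u o ∩ {ω | ¬ (openGraph ω).Reachable u x} ∩ {ω | ¬ (openGraph ω).Reachable u y} ∩ {ω | ¬ (openGraph ω).Reachable u z}), F (openCluster ω u) ∂(prodBernoulli w) :=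
    setIntegral_congr_fun (hmeas _) fun ω hω => by
      rw [openCluster_eq_of_reachable (show (openGraph ω).Reachable u o from hω.1.1.1)]
  have cBxy : ∫ ω in (openConn x o ∩ openConn x y ∩ {ω | ¬ (openGraph ω).Reachable x u} ∩ {ω | ¬ (openGraph ω).Reachable x z}), F (openCluster ω o) ∂(prodBernoulli w) = ∫ ω in (openConn x o ∩ openConn x y ∩ {ω | ¬ (openGraph ω).Reachable x u} ∩ {ω | ¬ (openGraph ω).Reachable x z}), F (openCluster ω x) ∂(prodBernoulli w) :=
    setIntegral_congr_fun (hmeas _) fun ω hω => by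
      rw [openCluster_eq_of_reachable (show (openGraph ω).Reachable x o from hω.1.1.1)]
  have cBxu : ∫ ω in (openConn x o ∩ openConn x u ∩ {ω | ¬ (openGraph ω).Reachable x y} ∩ {ω | ¬ (openGraph ω).Reachable x z}), F (openCluster ω o) ∂(prodBernoulli w) = ∫ ω in (openConn x o ∩ openConn x u ∩ {ω | ¬ (openGraph ω).Reachable x y} ∩ {ω | ¬ (openGraph ω).Reachable x z}), F (openCluster ω x) ∂(prodBernoulli w) :=
    setIntegral_congr_fun (hmeas _) fun ω hω => by
      rw [openCluster_eq_of_reachable (show (openGraph ω).Reachable x o from hω.1.1.1)]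
  have cByu : ∫ ω in (openConn y o ∩ openConn y u ∩ {ω | ¬ (openGraph ω).Reachable y x} ∩ {ω | ¬ (openGraph ω).Reachable y z}), F (openCluster ω o) ∂(prodBernoulli w) = ∫ ω in (openConn y o ∩ openConn y u ∩ {ω | ¬ (openGraph ω).Reachable y x} ∩ {ω | ¬ (openGraph ω).Reachable y z}), F (openCluster ω y) ∂(prodBernoulli w) :=
    setIntegral_congr_fun (hmeas _) fun ω hω => by
      rw [openCluster_eq_of_reachable (show (openGraph ω).Reachable y o from hω.1.1.1)]
  have cTx : ∫ ω in (openConn x o ∩ openConn x y ∩ openConn x u ∩ {ω | ¬ (openGraph ω).Reachable x z}), F (openCluster ω o) ∂(prodBernoulli w) = ∫ ω in (openConn x o ∩ openConn x y ∩ openConn x u ∩ {ω | ¬ (openGraph ω).Reachable x z}), F (openCluster ω x) ∂(prodBernoulli w) :=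
    setIntegral_congr_fun (hmeas _) fun ω hω => by
      rw [openCluster_eq_of_reachable (show (openGraph ω).Reachable x o from hω.1.1.1)]
  rw [cAx, cAy, cAu, cBxy, cBxu, cByu, cTx] at sO
  -- `D_i` on `{i↮z}`
  have hDi : ∀ i : V, (∫ ω, F (openCluster ω i) ∂(prodBernoulli w)) - ∫ ω, F (openCluster ω z) ∂(prodBernoulli w) =
      (∫ ω in {ω : BondConfig V | ¬ (openGraph ω).Reachable i z}, F (openCluster ω i) ∂(prodBernoulli w)) -
        ∫ ω in {ω : BondConfig V | ¬ (openGraph ω).Reachable i z}, F (openCluster ω z) ∂(prodBernoulli w) := by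
    intro i
    have ei := integral_add_compl (hmeas {ω | ¬ (openGraph ω).Reachable i z}) (Integrable.of_finite : Integrable (fun ω => F (openCluster ω i)) (prodBernoulli w))
    have ez := integral_add_compl (hmeas {ω | ¬ (openGraph ω).Reachable i z}) (Integrable.of_finite : Integrable (fun ω => F (openCluster ω z)) (prodBernoulli w))
    have ec : ∫ ω in {ω : BondConfig V | ¬ (openGraph ω).Reachable i z}ᶜ, F (openCluster ω z) ∂(prodBernoulli w) =
        ∫ ω in {ω : BondConfig V | ¬ (openGraph ω).Reachable i z}ᶜ, F (openCluster ω i) ∂(prodBernoulli w) := by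
      refine setIntegral_congr_fun (hmeas _).compl fun ω hω => ?_
      have hr : (openGraph ω).Reachable i z := by by_contra hc; exact hω hc
      rw [openCluster_eq_of_reachable hr]
    linarith
  have hmin : ∀ (l a b : ℝ), 0 ≤ l → l ≤ 1 → min (a - b) 0 ≤ l * a - l * b := by
    intro l a b hl hl1
    rw [← mul_sub]
    by_cases ha : 0 ≤ a - b
    · rw [min_eq_right ha]; exact mul_nonneg hl ha
    · push Not at ha; rw [min_eq_left ha.le]; nlinarith
  have m1 := hmin lx (∫ ω in {ω : BondConfig V | ¬ (openGraph ω).Reachable x z}, F (openCluster ω x) ∂(prodBernoulli w))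
    (∫ ω in {ω : BondConfig V | ¬ (openGraph ω).Reachable x z}, F (openCluster ω z) ∂(prodBernoulli w)) hlx hlx1
  have m2 := hmin ly (∫ ω in {ω : BondConfig V | ¬ (openGraph ω).Reachable y z}, F (openCluster ω y) ∂(prodBernoulli w))
    (∫ ω in {ω : BondConfig V | ¬ (openGraph ω).Reachable y z}, F (openCluster ω z) ∂(prodBernoulli w)) hly hly1
  have m3 := hmin lu (∫ ω in {ω : BondConfig V | ¬ (openGraph ω).Reachable u z}, F (openCluster ω u) ∂(prodBernoulli w))
    (∫ ω in {ω : BondConfig V | ¬ (openGraph ω).Reachable u z}, F (openCluster ω z) ∂(prodBernoulli w)) hlu hlu1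
  -- from `J'` to `J`
  have hc : ∫ ω in (openConn o x ∪ openConn o y ∪ openConn o u) \ {ω | ¬ (openGraph ω).Reachable o z}, F (openCluster ω z) ∂(prodBernoulli w) =
      ∫ ω in (openConn o x ∪ openConn o y ∪ openConn o u) \ {ω | ¬ (openGraph ω).Reachable o z}, F (openCluster ω o) ∂(prodBernoulli w) := by
    refine setIntegral_congr_fun ((hmeas _).diff (hmeas _)) fun ω hω => ?_
    have hr : (openGraph ω).Reachable o z := by by_contra hc; exact hω.2 hc
    rw [openCluster_eq_of_reachable hr]
  rw [hDi x, hDi y, hDi u, ← integral_inter_add_sdiff (hmeas {ω | ¬ (openGraph ω).Reachable o z}) (hint _ (openConn o x ∪ openConn o y ∪ openConn o u)),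
    ← integral_inter_add_sdiff (hmeas {ω | ¬ (openGraph ω).Reachable o z}) (hint _ (openConn o x ∪ openConn o y ∪ openConn o u)), hc, sO, sZ]
  -- products `t * ∫` are atoms for linarith; the split identities close the books
  have e1 : txy * (∫ ω in (openConn x o ∩ openConn x y ∩ {ω | ¬ (openGraph ω).Reachable x u} ∩ {ω | ¬ (openGraph ω).Reachable x z}), F (openCluster ω x) ∂(prodBernoulli w)) + tyx * (∫ ω in (openConn x o ∩ openConn x y ∩ {ω | ¬ (openGraph ω).Reachable x u} ∩ {ω | ¬ (openGraph ω).Reachable x z}), F (openCluster ω x) ∂(prodBernoulli w)) =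
      ∫ ω in (openConn x o ∩ openConn x y ∩ {ω | ¬ (openGraph ω).Reachable x u} ∩ {ω | ¬ (openGraph ω).Reachable x z}), F (openCluster ω x) ∂(prodBernoulli w) := by rw [← add_mul, hxy, one_mul]
  have e2 : txu * (∫ ω in (openConn x o ∩ openConn x u ∩ {ω | ¬ (openGraph ω).Reachable x y} ∩ {ω | ¬ (openGraph ω).Reachable x z}), F (openCluster ω x) ∂(prodBernoulli w)) + tux * (∫ ω in (openConn x o ∩ openConn x u ∩ {ω | ¬ (openGraph ω).Reachable x y} ∩ {ω | ¬ (openGraph ω).Reachable x z}), F (openCluster ω x) ∂(prodBernoulli w)) =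
      ∫ ω in (openConn x o ∩ openConn x u ∩ {ω | ¬ (openGraph ω).Reachable x y} ∩ {ω | ¬ (openGraph ω).Reachable x z}), F (openCluster ω x) ∂(prodBernoulli w) := by rw [← add_mul, hxu, one_mul]
  have e3 : tyu * (∫ ω in (openConn y o ∩ openConn y u ∩ {ω | ¬ (openGraph ω).Reachable y x} ∩ {ω | ¬ (openGraph ω).Reachable y z}), F (openCluster ω y) ∂(prodBernoulli w)) + tuy * (∫ ω in (openConn y o ∩ openConn y u ∩ {ω | ¬ (openGraph ω).Reachable y x} ∩ {ω | ¬ (openGraph ω).Reachable y z}), F (openCluster ω y) ∂(prodBernoulli w)) =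
      ∫ ω in (openConn y o ∩ openConn y u ∩ {ω | ¬ (openGraph ω).Reachable y x} ∩ {ω | ¬ (openGraph ω).Reachable y z}), F (openCluster ω y) ∂(prodBernoulli w) := by rw [← add_mul, hyu, one_mul]
  have e4 : sx * (∫ ω in (openConn x o ∩ openConn x y ∩ openConn x u ∩ {ω | ¬ (openGraph ω).Reachable x z}), F (openCluster ω x) ∂(prodBernoulli w)) + sy * (∫ ω in (openConn x o ∩ openConn x y ∩ openConn x u ∩ {ω | ¬ (openGraph ω).Reachable x z}), F (openCluster ω x) ∂(prodBernoulli w)) +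
      su * (∫ ω in (openConn x o ∩ openConn x y ∩ openConn x u ∩ {ω | ¬ (openGraph ω).Reachable x z}), F (openCluster ω x) ∂(prodBernoulli w)) = ∫ ω in (openConn x o ∩ openConn x y ∩ openConn x u ∩ {ω | ¬ (openGraph ω).Reachable x z}), F (openCluster ω x) ∂(prodBernoulli w) := by rw [← add_mul, ← add_mul, hs, one_mul]
  have f1 : txy * (∫ ω in (openConn x o ∩ openConn x y ∩ {ω | ¬ (openGraph ω).Reachable x u} ∩ {ω | ¬ (openGraph ω).Reachable x z}), F (openCluster ω z) ∂(prodBernoulli w)) + tyx * (∫ ω in (openConn x o ∩ openConn x y ∩ {ω | ¬ (openGraph ω).Reachable x u} ∩ {ω | ¬ (openGraph ω).Reachable x z}), F (openCluster ω z) ∂(prodBernoulli w)) =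
      ∫ ω in (openConn x o ∩ openConn x y ∩ {ω | ¬ (openGraph ω).Reachable x u} ∩ {ω | ¬ (openGraph ω).Reachable x z}), F (openCluster ω z) ∂(prodBernoulli w) := by rw [← add_mul, hxy, one_mul]
  have f2 : txu * (∫ ω in (openConn x o ∩ openConn x u ∩ {ω | ¬ (openGraph ω).Reachable x y} ∩ {ω | ¬ (openGraph ω).Reachable x z}), F (openCluster ω z) ∂(prodBernoulli w)) + tux * (∫ ω in (openConn x o ∩ openConn x u ∩ {ω | ¬ (openGraph ω).Reachable x y} ∩ {ω | ¬ (openGraph ω).Reachable x z}), F (openCluster ω z) ∂(prodBernoulli w)) =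
      ∫ ω in (openConn x o ∩ openConn x u ∩ {ω | ¬ (openGraph ω).Reachable x y} ∩ {ω | ¬ (openGraph ω).Reachable x z}), F (openCluster ω z) ∂(prodBernoulli w) := by rw [← add_mul, hxu, one_mul]
  have f3 : tyu * (∫ ω in (openConn y o ∩ openConn y u ∩ {ω | ¬ (openGraph ω).Reachable y x} ∩ {ω | ¬ (openGraph ω).Reachable y z}), F (openCluster ω z) ∂(prodBernoulli w)) + tuy * (∫ ω in (openConn y o ∩ openConn y u ∩ {ω | ¬ (openGraph ω).Reachable y x} ∩ {ω | ¬ (openGraph ω).Reachable y z}), F (openCluster ω z) ∂(prodBernoulli w)) =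
      ∫ ω in (openConn y o ∩ openConn y u ∩ {ω | ¬ (openGraph ω).Reachable y x} ∩ {ω | ¬ (openGraph ω).Reachable y z}), F (openCluster ω z) ∂(prodBernoulli w) := by rw [← add_mul, hyu, one_mul]
  have f4 : sx * (∫ ω in (openConn x o ∩ openConn x y ∩ openConn x u ∩ {ω | ¬ (openGraph ω).Reachable x z}), F (openCluster ω z) ∂(prodBernoulli w)) + sy * (∫ ω in (openConn x o ∩ openConn x y ∩ openConn x u ∩ {ω | ¬ (openGraph ω).Reachable x z}), F (openCluster ω z) ∂(prodBernoulli w)) +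
      su * (∫ ω in (openConn x o ∩ openConn x y ∩ openConn x u ∩ {ω | ¬ (openGraph ω).Reachable x z}), F (openCluster ω z) ∂(prodBernoulli w)) = ∫ ω in (openConn x o ∩ openConn x y ∩ openConn x u ∩ {ω | ¬ (openGraph ω).Reachable x z}), F (openCluster ω z) ∂(prodBernoulli w) := by rw [← add_mul, ← add_mul, hs, one_mul]
  linarith [hOx, hOy, hOu, hZx, hZy, hZu, e1, e2, e3, e4, f1, f2, f3, f4, m1, m2, m3]

/-- **(GΨ₄) from the three observer halves**: under the hypotheses of `gpsi_four_robust_of_halves`, if moreover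
`E F(C z) ≤ E F(C i)` for `i = x, y, u`, then `∫_J F(C z) ≤ ∫_J F(C o)`, `J = o↔x ∪ o↔y ∪ o↔u`.
[cite: KozmaNitzan2024, Conjecture 4 (p. 32), Question 7 (p. 36)] -/
theorem gpsi_four_of_halves (w : Sym2 V → unitInterval) (o x y u z : V) (F : Set V → ℝ)
    (hF : ∀ S T : Set V, S ⊆ T → F S ≤ F T)
    (txy tyx txu tux tyu tuy sx sy su lx ly lu : ℝ)
    (hxy : txy + tyx = 1) (hxu : txu + tux = 1) (hyu : tyu + tuy = 1) (hs : sx + sy + su = 1)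
    (hlx : 0 ≤ lx) (hlx1 : lx ≤ 1) (hly : 0 ≤ ly) (hly1 : ly ≤ 1) (hlu : 0 ≤ lu) (hlu1 : lu ≤ 1)
    (hPx : (∀ G : Set V → ℝ, (∀ S T : Set V, S ⊆ T → G S ≤ G T) →
      lx * ∫ ω in {ω : BondConfig V | ¬ (openGraph ω).Reachable x z}, G (openCluster ω x) ∂(prodBernoulli w) ≤
        (∫ ω in (openConn x o ∩ {ω | ¬ (openGraph ω).Reachable x y} ∩ {ω | ¬ (openGraph ω).Reachable x u} ∩ {ω | ¬ (openGraph ω).Reachable x z}), G (openCluster ω x) ∂(prodBernoulli w)) +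
        txy * (∫ ω in (openConn x o ∩ openConn x y ∩ {ω | ¬ (openGraph ω).Reachable x u} ∩ {ω | ¬ (openGraph ω).Reachable x z}), G (openCluster ω x) ∂(prodBernoulli w)) +
        txu * (∫ ω in (openConn x o ∩ openConn x u ∩ {ω | ¬ (openGraph ω).Reachable x y} ∩ {ω | ¬ (openGraph ω).Reachable x z}), G (openCluster ω x) ∂(prodBernoulli w)) +
        sx * (∫ ω in (openConn x o ∩ openConn x y ∩ openConn x u ∩ {ω | ¬ (openGraph ω).Reachable x z}), G (openCluster ω x) ∂(prodBernoulli w))))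
    (hPy : (∀ G : Set V → ℝ, (∀ S T : Set V, S ⊆ T → G S ≤ G T) →
      ly * ∫ ω in {ω : BondConfig V | ¬ (openGraph ω).Reachable y z}, G (openCluster ω y) ∂(prodBernoulli w) ≤
        (∫ ω in (openConn y o ∩ {ω | ¬ (openGraph ω).Reachable y x} ∩ {ω | ¬ (openGraph ω).Reachable y u} ∩ {ω | ¬ (openGraph ω).Reachable y z}), G (openCluster ω y) ∂(prodBernoulli w)) +
        tyx * (∫ ω in (openConn y o ∩ openConn y x ∩ {ω | ¬ (openGraph ω).Reachable y u} ∩ {ω | ¬ (openGraph ω).Reachable y z}), G (openCluster ω y) ∂(prodBernoulli w)) +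
        tyu * (∫ ω in (openConn y o ∩ openConn y u ∩ {ω | ¬ (openGraph ω).Reachable y x} ∩ {ω | ¬ (openGraph ω).Reachable y z}), G (openCluster ω y) ∂(prodBernoulli w)) +
        sy * (∫ ω in (openConn y o ∩ openConn y x ∩ openConn y u ∩ {ω | ¬ (openGraph ω).Reachable y z}), G (openCluster ω y) ∂(prodBernoulli w))))
    (hPu : (∀ G : Set V → ℝ, (∀ S T : Set V, S ⊆ T → G S ≤ G T) →
      lu * ∫ ω in {ω : BondConfig V | ¬ (openGraph ω).Reachable u z}, G (openCluster ω u) ∂(prodBernoulli w) ≤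
        (∫ ω in (openConn u o ∩ {ω | ¬ (openGraph ω).Reachable u x} ∩ {ω | ¬ (openGraph ω).Reachable u y} ∩ {ω | ¬ (openGraph ω).Reachable u z}), G (openCluster ω u) ∂(prodBernoulli w)) +
        tux * (∫ ω in (openConn u o ∩ openConn u x ∩ {ω | ¬ (openGraph ω).Reachable u y} ∩ {ω | ¬ (openGraph ω).Reachable u z}), G (openCluster ω u) ∂(prodBernoulli w)) +
        tuy * (∫ ω in (openConn u o ∩ openConn u y ∩ {ω | ¬ (openGraph ω).Reachable u x} ∩ {ω | ¬ (openGraph ω).Reachable u z}), G (openCluster ω u) ∂(prodBernoulli w)) +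
        su * (∫ ω in (openConn u o ∩ openConn u x ∩ openConn u y ∩ {ω | ¬ (openGraph ω).Reachable u z}), G (openCluster ω u) ∂(prodBernoulli w))))
    (hx : ∫ ω, F (openCluster ω z) ∂(prodBernoulli w) ≤ ∫ ω, F (openCluster ω x) ∂(prodBernoulli w))
    (hy : ∫ ω, F (openCluster ω z) ∂(prodBernoulli w) ≤ ∫ ω, F (openCluster ω y) ∂(prodBernoulli w))
    (hu : ∫ ω, F (openCluster ω z) ∂(prodBernoulli w) ≤ ∫ ω, F (openCluster ω u) ∂(prodBernoulli w)) :
    ∫ ω in (openConn o x ∪ openConn o y ∪ openConn o u), F (openCluster ω z) ∂(prodBernoulli w) ≤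
      ∫ ω in (openConn o x ∪ openConn o y ∪ openConn o u), F (openCluster ω o) ∂(prodBernoulli w) := by
  have key := gpsi_four_robust_of_halves w o x y u z F hF txy tyx txu tux tyu tuy sx sy su lx ly lu hxy hxu hyu hs
    hlx hlx1 hly hly1 hlu hlu1 hPx hPy hPu
  rw [min_eq_right (sub_nonneg.2 hx), min_eq_right (sub_nonneg.2 hy), min_eq_right (sub_nonneg.2 hu), add_zero, add_zero] at key
  linarith

end Q7Psi

end

end Summit.CriticalPhenomena.PercolationContinuityZ3.Theorems
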